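/-
Copyright (c) 2026 the pub-hodgecm-mathlib formalisation cell (harness21).  Prover seat hodgecm-mathlib-F0P3a-p04 (g20): road «S3-ram» (LEAD F0P3a-plan (g13);
(Cnt2′) chair F0P3a-p07; (α) block-law keeper a.i. F0P3a-p06 (g16)), type-(2) hyperbolic census «HYP2», organ (T2-V0)+(T2-V1) «ADAPTED BLOCK FRAME & VERTEX SHAPE»; 2026-09-02.
-/
import Literature.NumberTheory.Automorphic.UnitaryLatticeTreeIsocelesVertexLineCountsRamified   -- ★ (V2) p848264 (LH4-p02): the SHAPE census `ncard_children_{null,quadraticChar}_…_of_shape[_end]`; brings `ringChar_residueField_ne_two`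
import Literature.NumberTheory.Automorphic.UnitaryLatticeTreeAxisEndoFrame                    -- ★ (z1-a) p847645 (F0P3a-p07): `coe_endoGL_eq_endoShape`; brings ★ `endoGL`, `endoGL_mem_iff`, `endoForm_eq`
import Literature.NumberTheory.Automorphic.UnitaryLatticeTreeFixedGrandchildFrameRamified        -- ★ FILE L p847541 (F0P2-p01): `latticeGraphIso_root_eq_of_mem_unitaryInt`; brings `latticeGraphIso_mul_apply`
import HarnessLib

/-!
# The lattice tree of the ramified `U(3)`: ADAPTED BLOCK FRAME AND VERTEX SHAPE of a type-(2) literal `ι(γ₂, u)` at an axis vertex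
# (Bruhat–Tits 1972 §10; Kottwitz 1986 §3; Rogawski 1990 §4.8–4.9)

Topic `NumberTheory/Automorphic`; namespace `Literature.NumberTheory.Automorphic.UnitaryLatticeTree`.  THEOREMS ONLY (no definition, no instance, no notation, no named fact,
no `sorry`); kernel lane `--supports stmt-HodgeConjecture-24833`; datum-free (`K` with `Valued K ℤᵐ⁰`, `σϖ = −ϖ`, `σ̄ = id`, `|2| = 1`).  Cell `pub/hodgecm-mathlib` (D-0151),
crux H413; road «S3-ram» (Literature seeding, count-neutral); (T2) G-side organ (Cnt2′) of the fold, route B: the PER-REGION-VERTEX CENSUS of the hyperbolic block literal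
`Γ = ι(γ₂, u) ∈ U(σ, J₀)` (the `hPE ∕ hPP ∕ hPM` census binders of ★ `strataCount_J₀_block_raw`, F0P2-p02 (g14)).  This file is the type-(2) twin of ★ (V0)∕(V1)
`exists_adaptedFrame_of_mem_region` ∕ `isotropicValue_eq_vertexShape_of_region` (F0P3a-p04 (g19)) and feeds ★ (V2) LH4-p02's SHAPE census VERBATIM:

* (§1) **`dotProduct_antidiagonal_three_mul_mulVec_of_block_adapted`** (residual algebra, `char ≠ 2`): if `Ȳ ∈ M₃(k)` is `ι`-SHAPED (`Ȳ₀₁ = Ȳ₁₀ = Ȳ₁₂ = Ȳ₂₁ = 0`) and ADAPTED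
  (`Ȳ₂₀ = 0`), then on the cone `2x₀x₂ + x₁² = 0` its isotropic value is `ᵗx(J̄₀Ȳ)x = (Ȳ₁₁ − (Ȳ₀₀ + Ȳ₂₂)∕2)·(x₁ + 0·x₂)² + Ȳ₀₂·x₂²` — ★ (V2)'s SHAPE with `t = 0`.
* (§2) **`residue_apply_eq_and_offDiag_dichotomy_of_unitary_two`**: for `γ₂ ∈ U(σ, antidiag(1,1))`, `D` ODD, `|γ₂ − 1| ≤ |ϖ|^D` entrywise and SMALL DISCRIMINANT
  `|tr² − 4 det| < |ϖ|^{2D}` (i.e. the W-block is strictly above the bottom of its fixed ball), the residual matrix `T̄ = res(ϖ^{−D}(γ₂ − 1))` has `T̄₀₀ = T̄₁₁` (the first-order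
  unitarity relation at odd depth: `J₂T̄` is SYMMETRIC since `σ(ϖ^D) = −ϖ^D`, `σ̄ = id`) and `T̄₁₀ = 0 ∨ T̄₀₁ = 0` (`tr² − 4det = ϖ^{2D}((t₀₀ − t₁₁)² + 4t₀₁t₁₀)`): the centred part of `T̄` is
  NILPOTENT OF RANK ≤ 1 WITH ISOTROPIC IMAGE — the structural reason behind B-p14 (g40)'s numeric «KIND A ∕ KIND B» law (MEMO v2 (L4)).
* (§3) the W-FLIP `w₀ = antidiag(1,1)`: `ι(w₀, 1) ∈ U(σ, J₀) ∩ GL₃(𝒪)` fixes the root `L₀` and conjugation by `w₀` swaps both indices of a `2 × 2` block (no definition is introduced: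
  the flip is an `∃`).
* (§4) **`exists_adaptedBlockFrame`** (T2-V0): if the literal is BLOCK in the vertex frame `u` (`↑(u⁻¹γu) = ι(g′, u′)`, e.g. `u = ι(κ_W, 1)` at an axis vertex `v = u·L₀`), `D` odd,
  `|g′ − 1| ≤ |ϖ|^D`, `|tr² − 4det|(g′) < |ϖ|^{2D}`, then there is a frame `u₁` of the SAME vertex (`u₁·L₀ = u·L₀`; `u₁ ∈ {u, u·ι(w₀,1)}`) in which the literal is block
  `ι(g₁, u′)` with the same depth bound, trace and determinant, ADAPTED (`|g₁,₁₀| < |ϖ|^D`) and J-SYMMETRIC (`|(g₁,₀₀ − 1) − (g₁,₁₁ − 1)| < |ϖ|^D`).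
* (§5) **`blockVertexShape_of_adapted`** (T2-V1): in an adapted block frame, the integral matrix `Y₀ = ϖ^{−D}(↑(u⁻¹γu) − 1)` of ★ (V2)'s census has the SHAPE
  `c(x₁ + 0·x₂)² + l·x₂²` with `c = res(Y₀,₁₁) − (res(Y₀,₀₀) + res(Y₀,₂₂))∕2`, `l = res(Y₀,₀₂)`; **`blockVertexShape_keys`**: in the frame of §4, `c = res(ϖ^{−D}(u′₀₀ − g₁,₀₀))`
  and `l = res(ϖ^{−D} g₁,₀₁)`, with `l = 0 ⟺` the CENTRED block `g₁ − ½tr·1` is deeper than `D` entrywise (the vertex is INTERIOR to the fixed W-ball of centred level `D+1`;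
  boundary vertices have `l ≠ 0` and KIND `χ(−lc)`).  Hence ★ (V2) gives, per axis region vertex: interior `{2 axial null lines, q−1 lines of class χ(c₀c)}`, boundary
  `{2 + χ(−lc) null, (q−1−χ(−lc)−σχ(c₀c))∕2 of class σ}` — B-p14's table digit for digit (q = 3, 5, 7).
HONEST LABEL: HC_CM is proved only modulo the 2 remaining named inputs (hLiu418 24832, h413 24833) until rung 0 closes; nothing printed is asserted here (matrix algebra over a
valuation ring); «S3-ram» has no books consequence.

## References
* [BruhatTits1972] F. Bruhat, J. Tits, *Groupes réductifs sur un corps local I*, Publ. Math. IHÉS 41 (1972), §10 (lattice models of the building; vertex stabilisers).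
* [Kottwitz1986] R. E. Kottwitz, *Base change for unit elements of Hecke algebras*, Compositio Math. 60 (1986), §3 (counting fixed lattices by residual quadrics).
* [Rogawski1990] J. D. Rogawski, *Automorphic Representations of Unitary Groups in Three Variables*, Ann. of Math. Stud. 123 (1990), §4.8 Case (a) p. 53 (the pattern
  `(* 0 *; 0 * 0; * 0 *)`), §4.9 Prop. 4.9.1 (b) p. 55, Lemma 4.9.3 p. 56 (the strata of the ramified orbital integrals).
* [LabesseLanglands1979] J.-P. Labesse, R. P. Langlands, *L-indistinguishability for SL(2)*, Canad. J. Math. 31 (1979), §2 (the rank-2 block).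
-/

set_option autoImplicit false

noncomputable section

open scoped Valued WithZero Matrix MatrixGroups
open Literature.NumberTheory.Automorphic Literature.NumberTheory.Automorphic.HermitianLattice Literature.NumberTheory.Automorphic.UnitaryLatticeTree
open Literature.NumberTheory.Rogawski1990 Literature.NumberTheory.Automorphic.UnitaryGroup

namespace Literature.NumberTheory.Automorphic.UnitaryLatticeTree

variable {K : Type*} [Field K] [Valued K ℤᵐ⁰] {σ : K →+* K} {ϖ : K}

/-! ## §1 Residual algebra: the SHAPE of an adapted `ι`-shaped matrix on the cone -/

section Residual

variable {F : Type*} [Field F]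

/-- **THE SHAPE OF AN ADAPTED BLOCK MATRIX** (`char ≠ 2`): for `Ȳ ∈ M₃(k)` with `Ȳ₀₁ = Ȳ₁₀ = Ȳ₁₂ = Ȳ₂₁ = 0` (`ι`-shaped) and `Ȳ₂₀ = 0` (adapted), the isotropic value on the
cone `2x₀x₂ + x₁² = 0` is `ᵗx(J̄₀Ȳ)x = (Ȳ₁₁ − (Ȳ₀₀ + Ȳ₂₂)∕2)·(x₁ + 0·x₂)² + Ȳ₀₂·x₂²` — ★ (V2)'s SHAPE with `t = 0` (`ᵗx(J̄₀Ȳ)x = (Ȳ₀₀+Ȳ₂₂)x₀x₂ + Ȳ₁₁x₁² + Ȳ₀₂x₂²` and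
`x₀x₂ = −x₁²∕2` on the cone). [cite: Kottwitz1986, §3] [cite: Rogawski1990, §4.9 Prop. 4.9.1 (b) p. 55] -/
theorem dotProduct_antidiagonal_three_mul_mulVec_of_block_adapted (h2 : (2 : F) ≠ 0)
    (Y : Matrix (Fin 3) (Fin 3) F) (h01 : Y 0 1 = 0) (h10 : Y 1 0 = 0) (h12 : Y 1 2 = 0) (h21 : Y 2 1 = 0) (h20 : Y 2 0 = 0)
    (x : Fin 3 → F) (hx : 2 * x 0 * x 2 + x 1 ^ 2 = 0) :
    x ⬝ᵥ ((((StdForm.antidiagonal 3).over F) * Y) *ᵥ x) = (Y 1 1 - (Y 0 0 + Y 2 2) / 2) * (x 1 + 0 * x 2) ^ 2 + Y 0 2 * x 2 ^ 2 := by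
  rw [← Matrix.mulVec_mulVec, dotProduct_antidiagonal_three_mulVec_eq_sum, Fin.sum_univ_three,
    show Fin.rev (2 : Fin 3) = 0 from rfl, show Fin.rev (0 : Fin 3) = 2 from rfl, show Fin.rev (1 : Fin 3) = 1 from rfl]
  simp only [Matrix.mulVec, dotProduct, Fin.sum_univ_three, h01, h10, h12, h21, h20, zero_mul, add_zero, zero_add]
  have hx' : x 0 * x 2 = -(x 1 ^ 2) / 2 := by
    field_simp
    linear_combination hx
  have hval : x 0 * (Y 2 2 * x 2) + x 1 * (Y 1 1 * x 1) + x 2 * (Y 0 0 * x 0 + Y 0 2 * x 2) =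
      (Y 0 0 + Y 2 2) * (x 0 * x 2) + Y 1 1 * x 1 ^ 2 + Y 0 2 * x 2 ^ 2 := by ring
  rw [hval, hx']
  field_simp
  ring

end Residual

/-! ## §2 The rank-2 block at odd depth: J-symmetry and the off-diagonal dichotomy of the residual matrix -/

/-- **J-SYMMETRY AND THE OFF-DIAGONAL DICHOTOMY** for a `2 × 2` block `g ∈ U(σ, antidiag(1,1))` with `|g − 1| ≤ |ϖ|^D` entrywise, `D` ODD, and SMALL DISCRIMINANT
`|tr(g)² − 4det(g)| < |ϖ|^{2D}`: writing `T = ϖ^{−D}(g − 1) ∈ M₂(𝒪)`, (i) **`res T₀₀ = res T₁₁`** — the `(0,1)` entry of `ᵗ(σg)·J₂·g = J₂` reads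
`t₁₁ − σt₀₀ = ϖ^D(σt₀₀·t₁₁ + σt₁₀·t₀₁)` because `σ(ϖ^D) = −ϖ^D` at ODD `D`, and `|σt₀₀ − t₀₀| < 1`; (ii) **`res T₁₀ = 0 ∨ res T₀₁ = 0`** —
`tr² − 4det = ϖ^{2D}·((t₀₀ − t₁₁)² + 4t₀₁t₁₀)`, so `|t₀₁t₁₀| < 1`.  I.e. the centred residual block is NILPOTENT of rank `≤ 1` with ISOTROPIC image: the structure behind the
«kind A ∕ kind B» split of the boundary vertices of the fixed W-ball (cf. ★ `UnitaryLatticeTreeTypeTwoCentredParity` (W3) «centred depths are odd»).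
[cite: LabesseLanglands1979, §2] [cite: Kottwitz1986, §3] [cite: Rogawski1990, §4.9 Lemma 4.9.3 p. 56] -/
theorem residue_apply_eq_and_offDiag_dichotomy_of_unitary_two (hvσ : ∀ a, Valued.v (σ a) = Valued.v a) (hσϖ : σ ϖ = -ϖ)
    (hϖ : Valued.v ϖ = WithZero.exp (-1 : ℤ)) (hres : ∀ x : K, Valued.v x ≤ 1 → Valued.v (σ x - x) < 1) (h2 : Valued.v (2 : K) = 1)
    (g : Matrix (Fin 2) (Fin 2) K) (hg : (g.map σ)ᵀ * !![(0 : K), 1; 1, 0] * g = !![(0 : K), 1; 1, 0])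
    {D : ℕ} (hD : Odd D) (T : Matrix (Fin 2) (Fin 2) 𝒪[K]) (hT : ∀ i j, ((T i j : 𝒪[K]) : K) = (ϖ ^ D)⁻¹ * (g - 1) i j)
    (hdisc : Valued.v (g.trace ^ 2 - 4 * g.det) < Valued.v ϖ ^ (2 * D)) :
    IsLocalRing.residue 𝒪[K] (T 0 0) = IsLocalRing.residue 𝒪[K] (T 1 1) ∧
      (IsLocalRing.residue 𝒪[K] (T 1 0) = 0 ∨ IsLocalRing.residue 𝒪[K] (T 0 1) = 0) := by
  have hϖ0 : ϖ ≠ 0 := fun h0 => by rw [h0, map_zero] at hϖ; exact WithZero.coe_ne_zero hϖ.symm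
  have hϖ1 : Valued.v ϖ < 1 := by rw [hϖ, ← WithZero.exp_zero]; exact WithZero.exp_lt_exp.2 (by norm_num)
  have hϖD0 : (ϖ ^ D : K) ≠ 0 := pow_ne_zero _ hϖ0
  have hD1 : 1 ≤ D := hD.pos
  have hϖD1 : Valued.v (ϖ ^ D) < 1 := by
    rw [map_pow]; exact pow_lt_one₀ zero_le hϖ1 (by omega)
  -- entries of `g` in terms of `T`
  have hent : ∀ i j, g i j = (1 : Matrix (Fin 2) (Fin 2) K) i j + ϖ ^ D * (T i j : K) := fun i j => by
    rw [hT, mul_inv_cancel_left₀ hϖD0, Matrix.sub_apply]; ring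
  have h00 := hent 0 0; have h01 := hent 0 1; have h10 := hent 1 0; have h11 := hent 1 1
  simp only [Matrix.one_apply_eq, Matrix.one_apply_ne (show (0 : Fin 2) ≠ 1 by decide),
    Matrix.one_apply_ne (show (1 : Fin 2) ≠ 0 by decide), zero_add] at h00 h01 h10 h11
  have hσϖD : σ (ϖ ^ D) = -(ϖ ^ D) := by rw [map_pow, hσϖ, hD.neg_pow]
  -- (a) the `(0,1)` entry of the unitarity relation
  have hu := congrArg (fun A => A 0 1) hg
  simp only [Matrix.mul_apply, Fin.sum_univ_two, Matrix.transpose_apply, Matrix.map_apply, Matrix.of_apply, Matrix.cons_val',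
    Matrix.cons_val_zero, Matrix.cons_val_one, Matrix.empty_val', Matrix.cons_val_fin_one] at hu
  -- hu : σ(g 0 0) * 0 * g 0 1 + ... : let us restate it cleanly
  have hu' : σ (g 1 0) * g 0 1 + σ (g 0 0) * g 1 1 = 1 := by
    simpa [mul_zero, zero_mul, add_zero, zero_add, mul_one, one_mul] using hu
  rw [h00, h01, h10, h11, map_add, map_one, map_mul, map_mul, hσϖD] at hu'
  -- τ₁₁ − σ τ₀₀ = ϖ^D (σ τ₀₀ τ₁₁ + σ τ₁₀ τ₀₁)
  have hkey : (T 1 1 : K) - σ (T 0 0 : K) = ϖ ^ D * (σ (T 0 0 : K) * (T 1 1 : K) + σ (T 1 0 : K) * (T 0 1 : K)) := by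
    have := hu'
    apply mul_left_cancel₀ hϖD0
    linear_combination this
  have hint : ∀ i j, Valued.v (σ (T i j : K)) ≤ 1 := fun i j => by rw [hvσ]; exact (T i j).2
  have hsym : Valued.v ((T 1 1 : K) - (T 0 0 : K)) < 1 := by
    have h1 : Valued.v ((T 1 1 : K) - σ (T 0 0 : K)) < 1 := by
      rw [hkey, map_mul]
      refine mul_lt_one_of_lt_of_le hϖD1 ?_
      refine (Valued.v.map_add _ _).trans (max_le ?_ ?_)
      · rw [map_mul]; exact mul_le_one' (hint 0 0) (T 1 1).2
      · rw [map_mul]; exact mul_le_one' (hint 1 0) (T 0 1).2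
    have h2' : Valued.v (σ (T 0 0 : K) - (T 0 0 : K)) < 1 := hres _ (T 0 0).2
    have : (T 1 1 : K) - (T 0 0 : K) = ((T 1 1 : K) - σ (T 0 0 : K)) + (σ (T 0 0 : K) - (T 0 0 : K)) := by ring
    rw [this]
    exact (Valued.v.map_add _ _).trans_lt (max_lt h1 h2')
  have hres00 : IsLocalRing.residue 𝒪[K] (T 0 0) = IsLocalRing.residue 𝒪[K] (T 1 1) := by
    rw [eq_comm, ← sub_eq_zero, ← map_sub, residue_eq_zero_iff_v_lt_one]
    simpa using hsym
  refine ⟨hres00, ?_⟩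
  -- (b) the discriminant: tr² − 4 det = ϖ^{2D}((τ₀₀ − τ₁₁)² + 4 τ₀₁ τ₁₀)
  have hdisc_eq : g.trace ^ 2 - 4 * g.det = (ϖ ^ D) ^ 2 * (((T 0 0 : K) - (T 1 1 : K)) ^ 2 + 4 * ((T 0 1 : K) * (T 1 0 : K))) := by
    rw [Matrix.trace_fin_two, Matrix.det_fin_two, h00, h01, h10, h11]; ring
  have hX : Valued.v ((((T 0 0 : K) - (T 1 1 : K)) ^ 2 + 4 * ((T 0 1 : K) * (T 1 0 : K)))) < 1 := by
    rw [hdisc_eq, map_mul, map_pow, map_pow, ← pow_mul, mul_comm D 2] at hdisc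
    have hpos : 0 < Valued.v ϖ ^ (2 * D) := pow_pos (zero_lt_iff.2 ((Valuation.ne_zero_iff _).2 hϖ0)) _
    calc Valued.v ((((T 0 0 : K) - (T 1 1 : K)) ^ 2 + 4 * ((T 0 1 : K) * (T 1 0 : K))))
        = (Valued.v ϖ ^ (2 * D))⁻¹ * (Valued.v ϖ ^ (2 * D) * Valued.v ((((T 0 0 : K) - (T 1 1 : K)) ^ 2 + 4 * ((T 0 1 : K) * (T 1 0 : K))))) := by
          rw [inv_mul_cancel_left₀ hpos.ne']
      _ < (Valued.v ϖ ^ (2 * D))⁻¹ * Valued.v ϖ ^ (2 * D) := by exact mul_lt_mul_of_pos_left hdisc (inv_pos.2 hpos)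
      _ = 1 := inv_mul_cancel₀ hpos.ne'
  have hprod : Valued.v ((T 0 1 : K) * (T 1 0 : K)) < 1 := by
    have ha : Valued.v (((T 0 0 : K) - (T 1 1 : K)) ^ 2) < 1 := by
      rw [map_pow, ← neg_sub, Valuation.map_neg]; exact pow_lt_one₀ zero_le hsym two_ne_zero
    have : 4 * ((T 0 1 : K) * (T 1 0 : K)) = ((((T 0 0 : K) - (T 1 1 : K)) ^ 2 + 4 * ((T 0 1 : K) * (T 1 0 : K)))) - ((T 0 0 : K) - (T 1 1 : K)) ^ 2 := by ring
    have h4 : Valued.v (4 * ((T 0 1 : K) * (T 1 0 : K))) < 1 := by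
      rw [this]; exact (Valued.v.map_sub _ _).trans_lt (max_lt hX ha)
    have hv4 : Valued.v (4 : K) = 1 := by rw [show (4 : K) = 2 * 2 by norm_num, map_mul, h2, one_mul]
    rwa [map_mul, hv4, one_mul] at h4
  rw [residue_eq_zero_iff_v_lt_one, residue_eq_zero_iff_v_lt_one]
  by_contra hne
  rw [not_or, not_lt, not_lt] at hne
  have h1 : Valued.v ((T 1 0 : 𝒪[K]) : K) = 1 := le_antisymm (T 1 0).2 hne.1
  have h2' : Valued.v ((T 0 1 : 𝒪[K]) : K) = 1 := le_antisymm (T 0 1).2 hne.2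
  rw [map_mul, h1, h2', mul_one] at hprod
  exact lt_irrefl _ hprod

/-! ## §3 The W-flip `w₀ = antidiag(1,1)` and the pattern form `J₀ = ι(J₂, 1)` -/

omit [Valued K ℤᵐ⁰] in
/-- `J₀ = antidiag(1,1,1)` IS the pattern form of `J₂ = antidiag(1,1)` and `(1)`: `(StdForm.antidiagonal 3).over K = endoForm J₂ (1)` (★ `endoForm_antidiagOne` in matrix
literals). [cite: Rogawski1990, §4.8 Case (a) p. 53] -/
theorem antidiagonal_three_over_eq_endoForm_two_one :
    (StdForm.antidiagonal 3).over K = endoForm (!![(0 : K), 1; 1, 0]) (!![(1 : K)]) := by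
  rw [antidiagonal_three_over_eq, endoForm_eq]
  ext i j; fin_cases i <;> fin_cases j <;> rfl

omit [Valued K ℤᵐ⁰] in
/-- The W-block of a unitary `ι(g′, u′) ∈ U(σ, J₀)` is unitary for `J₂ = antidiag(1,1)` (★ `endoGL_mem_iff`). [cite: Rogawski1990, §4.8 Case (a) p. 53] -/
theorem block_mem_unitary_of_endoGL_mem {g' : GL (Fin 2) K} {u' : GL (Fin 1) K}
    (h : endoGL (g', u') ∈ unitaryGroupOfForm σ ((StdForm.antidiagonal 3).over K)) :
    (((g' : Matrix (Fin 2) (Fin 2) K)).map σ)ᵀ * !![(0 : K), 1; 1, 0] * (g' : Matrix (Fin 2) (Fin 2) K) = !![(0 : K), 1; 1, 0] := by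
  rw [antidiagonal_three_over_eq_endoForm_two_one, endoGL_mem_iff] at h
  exact h.1

omit [Valued K ℤᵐ⁰] in
/-- **The W-flip exists in `GL₂(K)`**: an element `w₀` with `↑w₀ = ↑w₀⁻¹ = antidiag(1,1)` (no definition is introduced). [cite: BruhatTits1972, §10] -/
theorem exists_flipTwo : ∃ w : GL (Fin 2) K, (w : Matrix (Fin 2) (Fin 2) K) = !![(0 : K), 1; 1, 0] ∧ ((w⁻¹ : GL (Fin 2) K) : Matrix (Fin 2) (Fin 2) K) = !![(0 : K), 1; 1, 0] :=
  ⟨⟨!![(0 : K), 1; 1, 0], !![(0 : K), 1; 1, 0],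
    by ext i j; fin_cases i <;> fin_cases j <;> simp [Matrix.mul_apply, Fin.sum_univ_two],
    by ext i j; fin_cases i <;> fin_cases j <;> simp [Matrix.mul_apply, Fin.sum_univ_two]⟩, rfl, rfl⟩

omit [Valued K ℤᵐ⁰] in
/-- Conjugation by the W-flip swaps both indices: `(w₀⁻¹ g w₀)_{ij} = g_{rev i, rev j}`. [cite: BruhatTits1972, §10] -/
theorem coe_flip_inv_mul_mul_flip_apply {w : GL (Fin 2) K} (hw : (w : Matrix (Fin 2) (Fin 2) K) = !![(0 : K), 1; 1, 0])
    (hw' : ((w⁻¹ : GL (Fin 2) K) : Matrix (Fin 2) (Fin 2) K) = !![(0 : K), 1; 1, 0]) (g : GL (Fin 2) K) (i j : Fin 2) :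
    (((w⁻¹ * g * w : GL (Fin 2) K)) : Matrix (Fin 2) (Fin 2) K) i j = (g : Matrix (Fin 2) (Fin 2) K) (Fin.rev i) (Fin.rev j) := by
  rw [Units.val_mul, Units.val_mul, hw', hw]
  fin_cases i <;> fin_cases j <;> simp [Matrix.mul_apply, Fin.sum_univ_two, Matrix.vecMul, dotProduct]

omit [Valued K ℤᵐ⁰] in
/-- `(w₀⁻¹ g w₀ − 1)_{ij} = (g − 1)_{rev i, rev j}`. [cite: BruhatTits1972, §10] -/
theorem coe_flip_conj_sub_one_apply {w : GL (Fin 2) K} (hw : (w : Matrix (Fin 2) (Fin 2) K) = !![(0 : K), 1; 1, 0])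
    (hw' : ((w⁻¹ : GL (Fin 2) K) : Matrix (Fin 2) (Fin 2) K) = !![(0 : K), 1; 1, 0]) (g : GL (Fin 2) K) (i j : Fin 2) :
    ((((w⁻¹ * g * w : GL (Fin 2) K)) : Matrix (Fin 2) (Fin 2) K) - 1) i j = ((g : Matrix (Fin 2) (Fin 2) K) - 1) (Fin.rev i) (Fin.rev j) := by
  rw [Matrix.sub_apply, Matrix.sub_apply, coe_flip_inv_mul_mul_flip_apply hw hw']
  fin_cases i <;> fin_cases j <;> rfl

omit [Valued K ℤᵐ⁰] in
/-- The flip preserves the trace. [cite: BruhatTits1972, §10] -/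
theorem trace_coe_flip_conj {w : GL (Fin 2) K} (hw : (w : Matrix (Fin 2) (Fin 2) K) = !![(0 : K), 1; 1, 0])
    (hw' : ((w⁻¹ : GL (Fin 2) K) : Matrix (Fin 2) (Fin 2) K) = !![(0 : K), 1; 1, 0]) (g : GL (Fin 2) K) :
    (((w⁻¹ * g * w : GL (Fin 2) K)) : Matrix (Fin 2) (Fin 2) K).trace = (g : Matrix (Fin 2) (Fin 2) K).trace := by
  rw [Matrix.trace_fin_two, Matrix.trace_fin_two, coe_flip_inv_mul_mul_flip_apply hw hw', coe_flip_inv_mul_mul_flip_apply hw hw',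
    show Fin.rev (0 : Fin 2) = 1 from rfl, show Fin.rev (1 : Fin 2) = 0 from rfl, add_comm]

omit [Valued K ℤᵐ⁰] in
/-- The flip preserves the determinant. [cite: BruhatTits1972, §10] -/
theorem det_coe_flip_conj {w : GL (Fin 2) K} (hw : (w : Matrix (Fin 2) (Fin 2) K) = !![(0 : K), 1; 1, 0])
    (hw' : ((w⁻¹ : GL (Fin 2) K) : Matrix (Fin 2) (Fin 2) K) = !![(0 : K), 1; 1, 0]) (g : GL (Fin 2) K) :
    (((w⁻¹ * g * w : GL (Fin 2) K)) : Matrix (Fin 2) (Fin 2) K).det = (g : Matrix (Fin 2) (Fin 2) K).det := by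
  rw [Matrix.det_fin_two, Matrix.det_fin_two]
  simp only [coe_flip_inv_mul_mul_flip_apply hw hw', show Fin.rev (0 : Fin 2) = 1 from rfl, show Fin.rev (1 : Fin 2) = 0 from rfl]
  ring

omit [Valued K ℤᵐ⁰] in
/-- **`ι(w₀, 1) ∈ U(σ, J₀)`** (both blocks are unitary: `ᵗw₀ J₂ w₀ = J₂`, `σ` fixes `0, 1`). [cite: Rogawski1990, §4.8 Case (a) p. 53] [cite: BruhatTits1972, §10] -/
theorem endoGL_flip_one_mem_unitary (σ : K →+* K) {w : GL (Fin 2) K} (hw : (w : Matrix (Fin 2) (Fin 2) K) = !![(0 : K), 1; 1, 0]) :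
    endoGL (w, (1 : GL (Fin 1) K)) ∈ unitaryGroupOfForm σ ((StdForm.antidiagonal 3).over K) := by
  rw [antidiagonal_three_over_eq_endoForm_two_one, endoGL_mem_iff]
  refine ⟨?_, ?_⟩
  · show ((w : Matrix (Fin 2) (Fin 2) K).map σ)ᵀ * !![(0 : K), 1; 1, 0] * (w : Matrix (Fin 2) (Fin 2) K) = !![(0 : K), 1; 1, 0]
    rw [hw]
    ext i j; fin_cases i <;> fin_cases j <;> simp [Matrix.mul_apply, Fin.sum_univ_two]
  · show ((((1 : GL (Fin 1) K)) : Matrix (Fin 1) (Fin 1) K).map σ)ᵀ * !![(1 : K)] * (((1 : GL (Fin 1) K)) : Matrix (Fin 1) (Fin 1) K) = !![(1 : K)]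
    rw [Units.val_one]
    ext i j; fin_cases i; fin_cases j; simp [Matrix.mul_apply]

omit [Valued K ℤᵐ⁰] in
/-- The matrix of `ι(w₀, 1)` is `antidiag(1,1,1)`. [cite: Rogawski1990, §4.8 Case (a) p. 53] -/
theorem coe_endoGL_flip_one {w : GL (Fin 2) K} (hw : (w : Matrix (Fin 2) (Fin 2) K) = !![(0 : K), 1; 1, 0]) :
    ((endoGL (w, (1 : GL (Fin 1) K)) : GL (Fin 3) K) : Matrix (Fin 3) (Fin 3) K) = !![(0 : K), 0, 1; 0, 1, 0; 1, 0, 0] := by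
  rw [coe_endoGL_eq_endoShape, hw, Units.val_one]
  ext i j; fin_cases i <;> fin_cases j <;> simp

/-- **`ι(w₀, 1) ∈ K₀ = U(σ, J₀) ∩ GL₃(𝒪)`** (entries `0, 1`; its inverse is `ι(w₀⁻¹, 1)` of the same shape). [cite: BruhatTits1972, §10] -/
theorem endoGL_flip_one_mem_unitaryInt {w : GL (Fin 2) K} (hw : (w : Matrix (Fin 2) (Fin 2) K) = !![(0 : K), 1; 1, 0])
    (hw' : ((w⁻¹ : GL (Fin 2) K) : Matrix (Fin 2) (Fin 2) K) = !![(0 : K), 1; 1, 0])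
    (W : unitaryGroupOfForm σ ((StdForm.antidiagonal 3).over K)) (hW : (W : GL (Fin 3) K) = endoGL (w, (1 : GL (Fin 1) K))) :
    W ∈ unitaryInt σ ((StdForm.antidiagonal 3).over K) := by
  rw [mem_unitaryInt_iff, hW]
  refine ⟨fun i j => ?_, fun i j => ?_⟩
  · rw [coe_endoGL_flip_one hw]
    fin_cases i <;> fin_cases j <;> simp
  · rw [← map_inv, Prod.inv_mk, inv_one, coe_endoGL_flip_one hw']
    fin_cases i <;> fin_cases j <;> simp

/-- `ι(w₀, 1)` fixes the root `L₀ = 𝒪³` (★ `latticeGraphIso_root_eq_of_mem_unitaryInt`). [cite: BruhatTits1972, §10] -/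
theorem latticeGraphIso_flip_root (hϖ : Valued.v ϖ = WithZero.exp (-1 : ℤ)) {w : GL (Fin 2) K} (hw : (w : Matrix (Fin 2) (Fin 2) K) = !![(0 : K), 1; 1, 0])
    (hw' : ((w⁻¹ : GL (Fin 2) K) : Matrix (Fin 2) (Fin 2) K) = !![(0 : K), 1; 1, 0])
    (W : unitaryGroupOfForm σ ((StdForm.antidiagonal 3).over K)) (hW : (W : GL (Fin 3) K) = endoGL (w, (1 : GL (Fin 1) K))) :
    latticeGraphIso σ ϖ ((StdForm.antidiagonal 3).over K) W ⟨stdLattice K 3, 0, isSelfDualLattice_stdLattice_three_of_v hϖ⟩ =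
      ⟨stdLattice K 3, 0, isSelfDualLattice_stdLattice_three_of_v hϖ⟩ :=
  latticeGraphIso_root_eq_of_mem_unitaryInt hϖ (endoGL_flip_one_mem_unitaryInt hw hw' W hW)

omit [Valued K ℤᵐ⁰] in
/-- **Flipping a block frame**: if `↑(u⁻¹γu) = ι(g′, u′)` and `↑W = ι(w₀, 1)`, then `↑((uW)⁻¹ γ (uW)) = ι(w₀⁻¹ g′ w₀, u′)` (`ι` is a homomorphism).
[cite: Rogawski1990, §4.8 Case (a) p. 53] -/
theorem coe_conj_mul_flip (γ u : unitaryGroupOfForm σ ((StdForm.antidiagonal 3).over K)) (g' : GL (Fin 2) K) (u' : GL (Fin 1) K)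
    (hγu : ((u⁻¹ * γ * u : unitaryGroupOfForm σ ((StdForm.antidiagonal 3).over K)) : GL (Fin 3) K) = endoGL (g', u'))
    (w : GL (Fin 2) K) (W : unitaryGroupOfForm σ ((StdForm.antidiagonal 3).over K)) (hW : (W : GL (Fin 3) K) = endoGL (w, (1 : GL (Fin 1) K))) :
    (((u * W)⁻¹ * γ * (u * W) : unitaryGroupOfForm σ ((StdForm.antidiagonal 3).over K)) : GL (Fin 3) K) = endoGL (w⁻¹ * g' * w, u') := by
  have hre : (u * W)⁻¹ * γ * (u * W) = W⁻¹ * (u⁻¹ * γ * u) * W := by group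
  rw [hre, Subgroup.coe_mul, Subgroup.coe_mul, Subgroup.coe_inv, hγu, hW, ← map_inv, ← map_mul, ← map_mul]
  congr 1
  ext <;> simp

/-! ## §4 (T2-V0) An ADAPTED block frame exists at every axis vertex (the given W-frame or its flip) -/

/-- **(T2-V0) ADAPTED BLOCK FRAME.**  Let the literal `γ ∈ U(σ, J₀)` be BLOCK in the vertex frame `u` — `↑(u⁻¹γu) = ι(g′, u′)` (at an axis vertex `v = u·L₀`, `u = ι(κ_W, 1)`) —
with `D` ODD, `|g′ − 1| ≤ |ϖ|^D` entrywise and small discriminant `|tr(g′)² − 4det(g′)| < |ϖ|^{2D}` (the W-block strictly above the bottom of its fixed ball).  Then there is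
a frame `u₁` of the SAME vertex (`u₁·L₀ = u·L₀`; in fact `u₁ = u` or `u·ι(w₀,1)`) in which `γ` is block `ι(g₁, u′)` with the same line entry `u′`, the same depth bound, the
same trace and determinant, and which is **ADAPTED** `|ϖ^{−D} g₁,₁₀| < 1` and **J-SYMMETRIC** `|ϖ^{−D}((g₁ − 1)₀₀ − (g₁ − 1)₁₁)| < 1` (§2: flip iff `res T₀₁ = 0 ≠ res T₁₀`).
The type-(2) twin of ★ (V0) `exists_adaptedFrame_of_mem_region`. [cite: BruhatTits1972, §10] [cite: Kottwitz1986, §3] [cite: Rogawski1990, §4.9 Lemma 4.9.3 p. 56] -/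
theorem exists_adaptedBlockFrame (hvσ : ∀ a, Valued.v (σ a) = Valued.v a) (hσϖ : σ ϖ = -ϖ)
    (hϖ : Valued.v ϖ = WithZero.exp (-1 : ℤ)) (hres : ∀ x : K, Valued.v x ≤ 1 → Valued.v (σ x - x) < 1) (h2 : Valued.v (2 : K) = 1)
    (γ u : unitaryGroupOfForm σ ((StdForm.antidiagonal 3).over K)) (g' : GL (Fin 2) K) (u' : GL (Fin 1) K)
    (hγu : ((u⁻¹ * γ * u : unitaryGroupOfForm σ ((StdForm.antidiagonal 3).over K)) : GL (Fin 3) K) = endoGL (g', u'))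
    {D : ℕ} (hD : Odd D) (hdeep : ∀ i j, Valued.v (((g' : Matrix (Fin 2) (Fin 2) K) - 1) i j) ≤ Valued.v ϖ ^ D)
    (hdisc : Valued.v ((g' : Matrix (Fin 2) (Fin 2) K).trace ^ 2 - 4 * (g' : Matrix (Fin 2) (Fin 2) K).det) < Valued.v ϖ ^ (2 * D)) :
    ∃ u₁ : unitaryGroupOfForm σ ((StdForm.antidiagonal 3).over K),
      latticeGraphIso σ ϖ ((StdForm.antidiagonal 3).over K) u₁ ⟨stdLattice K 3, 0, isSelfDualLattice_stdLattice_three_of_v hϖ⟩ =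
        latticeGraphIso σ ϖ ((StdForm.antidiagonal 3).over K) u ⟨stdLattice K 3, 0, isSelfDualLattice_stdLattice_three_of_v hϖ⟩ ∧
      ∃ g₁ : GL (Fin 2) K, ((u₁⁻¹ * γ * u₁ : unitaryGroupOfForm σ ((StdForm.antidiagonal 3).over K)) : GL (Fin 3) K) = endoGL (g₁, u') ∧
        (∀ i j, Valued.v (((g₁ : Matrix (Fin 2) (Fin 2) K) - 1) i j) ≤ Valued.v ϖ ^ D) ∧
        (g₁ : Matrix (Fin 2) (Fin 2) K).trace = (g' : Matrix (Fin 2) (Fin 2) K).trace ∧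
        (g₁ : Matrix (Fin 2) (Fin 2) K).det = (g' : Matrix (Fin 2) (Fin 2) K).det ∧
        Valued.v ((ϖ ^ D)⁻¹ * (g₁ : Matrix (Fin 2) (Fin 2) K) 1 0) < 1 ∧
        Valued.v ((ϖ ^ D)⁻¹ * ((((g₁ : Matrix (Fin 2) (Fin 2) K) - 1) 0 0) - (((g₁ : Matrix (Fin 2) (Fin 2) K) - 1) 1 1))) < 1 := by
  have hϖ0 : ϖ ≠ 0 := fun h0 => by rw [h0, map_zero] at hϖ; exact WithZero.coe_ne_zero hϖ.symm
  have hϖD0 : (ϖ ^ D : K) ≠ 0 := pow_ne_zero _ hϖ0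
  have hvD : Valued.v ((ϖ ^ D)⁻¹ : K) * Valued.v ϖ ^ D = 1 := by rw [← map_pow, ← map_mul, inv_mul_cancel₀ hϖD0, map_one]
  -- the integral matrix `T = ϖ^{-D}(g' − 1)`
  have hTint : ∀ i j, Valued.v ((ϖ ^ D)⁻¹ * ((g' : Matrix (Fin 2) (Fin 2) K) - 1) i j) ≤ 1 := fun i j => by
    rw [map_mul]
    calc Valued.v ((ϖ ^ D)⁻¹ : K) * Valued.v (((g' : Matrix (Fin 2) (Fin 2) K) - 1) i j) ≤ Valued.v ((ϖ ^ D)⁻¹ : K) * Valued.v ϖ ^ D := by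
          gcongr; exact hdeep i j
      _ = 1 := hvD
  set T : Matrix (Fin 2) (Fin 2) 𝒪[K] := fun i j => ⟨(ϖ ^ D)⁻¹ * ((g' : Matrix (Fin 2) (Fin 2) K) - 1) i j, hTint i j⟩ with hTdef
  have hT : ∀ i j, ((T i j : 𝒪[K]) : K) = (ϖ ^ D)⁻¹ * ((g' : Matrix (Fin 2) (Fin 2) K) - 1) i j := fun i j => rfl
  have hunit : endoGL (g', u') ∈ unitaryGroupOfForm σ ((StdForm.antidiagonal 3).over K) := by rw [← hγu]; exact (u⁻¹ * γ * u).2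
  obtain ⟨hsym, hdich⟩ := residue_apply_eq_and_offDiag_dichotomy_of_unitary_two hvσ hσϖ hϖ hres h2 (g' : Matrix (Fin 2) (Fin 2) K)
    (block_mem_unitary_of_endoGL_mem hunit) hD T hT hdisc
  have hsymv : Valued.v ((ϖ ^ D)⁻¹ * ((((g' : Matrix (Fin 2) (Fin 2) K) - 1) 0 0) - (((g' : Matrix (Fin 2) (Fin 2) K) - 1) 1 1))) < 1 := by
    have h := hsym
    rw [← sub_eq_zero, ← map_sub, residue_eq_zero_iff_v_lt_one] at h
    simpa [hT, mul_sub] using h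
  rcases hdich with h10 | h01
  · -- the given frame is adapted
    refine ⟨u, rfl, g', hγu, hdeep, rfl, rfl, ?_, hsymv⟩
    rw [residue_eq_zero_iff_v_lt_one, hT, Matrix.sub_apply, Matrix.one_apply_ne (by decide), sub_zero] at h10
    exact h10
  · -- flip the W-frame
    obtain ⟨w, hw, hw'⟩ := (exists_flipTwo : ∃ w : GL (Fin 2) K, _)
    let W : unitaryGroupOfForm σ ((StdForm.antidiagonal 3).over K) := ⟨endoGL (w, (1 : GL (Fin 1) K)), endoGL_flip_one_mem_unitary σ hw⟩
    have hW : (W : GL (Fin 3) K) = endoGL (w, (1 : GL (Fin 1) K)) := rfl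
    refine ⟨u * W, ?_, w⁻¹ * g' * w, coe_conj_mul_flip γ u g' u' hγu w W hW, ?_, ?_, ?_, ?_, ?_⟩
    · rw [latticeGraphIso_mul_apply, latticeGraphIso_flip_root hϖ hw hw' W hW]
    · intro i j
      rw [coe_flip_conj_sub_one_apply hw hw']; exact hdeep _ _
    · exact trace_coe_flip_conj hw hw' g'
    · exact det_coe_flip_conj hw hw' g'
    · rw [coe_flip_inv_mul_mul_flip_apply hw hw', show Fin.rev (1 : Fin 2) = 0 from rfl, show Fin.rev (0 : Fin 2) = 1 from rfl]
      rw [residue_eq_zero_iff_v_lt_one, hT, Matrix.sub_apply, Matrix.one_apply_ne (by decide), sub_zero] at h01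
      exact h01
    · rw [coe_flip_conj_sub_one_apply hw hw', coe_flip_conj_sub_one_apply hw hw', show Fin.rev (1 : Fin 2) = 0 from rfl, show Fin.rev (0 : Fin 2) = 1 from rfl,
        ← neg_sub, mul_neg, Valuation.map_neg]
      exact hsymv

/-! ## §5 (T2-V1) The VERTEX SHAPE of the block literal in an adapted frame, and its keys -/

/-- **(T2-V1) BLOCK VERTEX SHAPE.**  In a block frame `u` of an axis vertex (`↑(u⁻¹γu) = ι(g′, u′)`) which is ADAPTED at depth `D` (`|ϖ^{−D} g′₁₀| < 1`), the integral
matrix `Y₀ = ϖ^{−D}(↑(u⁻¹γu) − 1)` of ★ (V2)'s census (`M := ↑(u⁻¹γu) − 1`, `d := D`) has isotropic values of the SHAPE `c·(x₁ + 0·x₂)² + l·x₂²` on the cone, with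
`c = res Y₀,₁₁ − (res Y₀,₀₀ + res Y₀,₂₂)∕2` and `l = res Y₀,₀₂` — so ★ `ncard_children_null_eq_two_of_shape` ∕ `…_of_shape_end` ∕ `ncard_children_quadraticChar_eq_of_shape` ∕
`two_mul_…_end` apply by `exact` with `t := 0`.  The type-(2) twin of ★ (V1) `isotropicValue_eq_vertexShape_of_region`.
[cite: Kottwitz1986, §3] [cite: Rogawski1990, §4.9 Prop. 4.9.1 (b) p. 55] [cite: BruhatTits1972, §10] -/
theorem blockVertexShape_of_adapted (h2 : Valued.v (2 : K) = 1)
    (γ u : unitaryGroupOfForm σ ((StdForm.antidiagonal 3).over K)) (g' : GL (Fin 2) K) (u' : GL (Fin 1) K)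
    (hγu : ((u⁻¹ * γ * u : unitaryGroupOfForm σ ((StdForm.antidiagonal 3).over K)) : GL (Fin 3) K) = endoGL (g', u'))
    {D : ℕ} (Y₀ : Matrix (Fin 3) (Fin 3) 𝒪[K])
    (hY₀ : ∀ a b, ((Y₀ a b : 𝒪[K]) : K) = (ϖ ^ D)⁻¹ * ((((u⁻¹ * γ * u : unitaryGroupOfForm σ ((StdForm.antidiagonal 3).over K)) : GL (Fin 3) K) : Matrix (Fin 3) (Fin 3) K) - 1) a b)
    (hadapt : Valued.v ((ϖ ^ D)⁻¹ * (g' : Matrix (Fin 2) (Fin 2) K) 1 0) < 1) :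
    ∀ x : Fin 3 → 𝓀[K], 2 * x 0 * x 2 + x 1 ^ 2 = 0 →
      x ⬝ᵥ ((((StdForm.antidiagonal 3).over 𝓀[K]) * Y₀.map (IsLocalRing.residue 𝒪[K])) *ᵥ x) =
        (IsLocalRing.residue 𝒪[K] (Y₀ 1 1) - (IsLocalRing.residue 𝒪[K] (Y₀ 0 0) + IsLocalRing.residue 𝒪[K] (Y₀ 2 2)) / 2) * (x 1 + 0 * x 2) ^ 2 +
          IsLocalRing.residue 𝒪[K] (Y₀ 0 2) * x 2 ^ 2 := by
  intro x hx
  have hent : ∀ a b, ((Y₀ a b : 𝒪[K]) : K) = (ϖ ^ D)⁻¹ * ((((endoGL (g', u') : GL (Fin 3) K)) : Matrix (Fin 3) (Fin 3) K) - 1) a b := fun a b => by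
    rw [hY₀, hγu]
  have hzero : ∀ a b, ((((endoGL (g', u') : GL (Fin 3) K)) : Matrix (Fin 3) (Fin 3) K) - 1) a b = 0 → IsLocalRing.residue 𝒪[K] (Y₀ a b) = 0 := by
    intro a b hab
    have : Y₀ a b = 0 := Subtype.ext (by rw [hent, hab, mul_zero]; rfl)
    rw [this, map_zero]
  have h01 : IsLocalRing.residue 𝒪[K] (Y₀ 0 1) = 0 := hzero 0 1 (by rw [Matrix.sub_apply, coe_endoGL_eq_endoShape]; simp)
  have h10 : IsLocalRing.residue 𝒪[K] (Y₀ 1 0) = 0 := hzero 1 0 (by rw [Matrix.sub_apply, coe_endoGL_eq_endoShape]; simp)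
  have h12 : IsLocalRing.residue 𝒪[K] (Y₀ 1 2) = 0 := hzero 1 2 (by rw [Matrix.sub_apply, coe_endoGL_eq_endoShape]; simp)
  have h21 : IsLocalRing.residue 𝒪[K] (Y₀ 2 1) = 0 := hzero 2 1 (by rw [Matrix.sub_apply, coe_endoGL_eq_endoShape]; simp)
  have h20 : IsLocalRing.residue 𝒪[K] (Y₀ 2 0) = 0 := by
    rw [residue_eq_zero_iff_v_lt_one, hent, Matrix.sub_apply, coe_endoGL_eq_endoShape, Matrix.one_apply_ne (by decide)]
    simpa using hadapt
  have h2k : (2 : 𝓀[K]) ≠ 0 := Ring.two_ne_zero (ringChar_residueField_ne_two h2)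
  have := dotProduct_antidiagonal_three_mul_mulVec_of_block_adapted h2k (Y₀.map (IsLocalRing.residue 𝒪[K]))
    (by rw [Matrix.map_apply, h01]) (by rw [Matrix.map_apply, h10]) (by rw [Matrix.map_apply, h12]) (by rw [Matrix.map_apply, h21])
    (by rw [Matrix.map_apply, h20]) x hx
  simpa only [Matrix.map_apply] using this

/-- **(T2-V1′) THE KEYS OF THE SHAPE in an adapted J-symmetric block frame** (the frame of §4): with `Y₀ = ϖ^{−D}(ι(g₁,u′) − 1)` integral, ADAPTED and J-SYMMETRIC, the SHAPE holds
with **`c = res(ϖ^{−D}(u′₀₀ − g₁,₀₀))`** (the line-minus-block residual scalar: `res Y₀,₁₁ − res Y₀,₀₀`, since `res Y₀,₀₀ = res Y₀,₂₂`) and **`l = res(ϖ^{−D} g₁,₀₁)`**, `t = 0`;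
hence `c = 0 ⟺ |ϖ^{−D}(u′₀₀ − g₁,₀₀)| < 1` (so `c ≠ 0` iff `|u′₀₀ − g₁,₀₀| = |ϖ|^D` exactly) and `l = 0 ⟺ |ϖ^{−D} g₁,₀₁| < 1`.  Stated with integer witnesses `CO`, `LO` as in ★ (V1).
[cite: Kottwitz1986, §3] [cite: Rogawski1990, §4.9 Prop. 4.9.1 (b) p. 55] [cite: BruhatTits1972, §10] -/
theorem blockVertexShape_keys (h2 : Valued.v (2 : K) = 1)
    (γ u : unitaryGroupOfForm σ ((StdForm.antidiagonal 3).over K)) (g₁ : GL (Fin 2) K) (u' : GL (Fin 1) K)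
    (hγu : ((u⁻¹ * γ * u : unitaryGroupOfForm σ ((StdForm.antidiagonal 3).over K)) : GL (Fin 3) K) = endoGL (g₁, u'))
    {D : ℕ} (Y₀ : Matrix (Fin 3) (Fin 3) 𝒪[K])
    (hY₀ : ∀ a b, ((Y₀ a b : 𝒪[K]) : K) = (ϖ ^ D)⁻¹ * ((((u⁻¹ * γ * u : unitaryGroupOfForm σ ((StdForm.antidiagonal 3).over K)) : GL (Fin 3) K) : Matrix (Fin 3) (Fin 3) K) - 1) a b)
    (hadapt : Valued.v ((ϖ ^ D)⁻¹ * (g₁ : Matrix (Fin 2) (Fin 2) K) 1 0) < 1)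
    (hsym : Valued.v ((ϖ ^ D)⁻¹ * ((((g₁ : Matrix (Fin 2) (Fin 2) K) - 1) 0 0) - (((g₁ : Matrix (Fin 2) (Fin 2) K) - 1) 1 1))) < 1)
    (CO : 𝒪[K]) (hCO : (CO : K) = (ϖ ^ D)⁻¹ * ((u' : Matrix (Fin 1) (Fin 1) K) 0 0 - (g₁ : Matrix (Fin 2) (Fin 2) K) 0 0))
    (LO : 𝒪[K]) (hLO : (LO : K) = (ϖ ^ D)⁻¹ * (g₁ : Matrix (Fin 2) (Fin 2) K) 0 1) :
    (∀ x : Fin 3 → 𝓀[K], 2 * x 0 * x 2 + x 1 ^ 2 = 0 →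
      x ⬝ᵥ ((((StdForm.antidiagonal 3).over 𝓀[K]) * Y₀.map (IsLocalRing.residue 𝒪[K])) *ᵥ x) =
        IsLocalRing.residue 𝒪[K] CO * (x 1 + 0 * x 2) ^ 2 + IsLocalRing.residue 𝒪[K] LO * x 2 ^ 2) ∧
    (IsLocalRing.residue 𝒪[K] CO = 0 ↔ Valued.v ((ϖ ^ D)⁻¹ * (((u' : Matrix (Fin 1) (Fin 1) K) 0 0 - (g₁ : Matrix (Fin 2) (Fin 2) K) 0 0))) < 1) ∧
    (IsLocalRing.residue 𝒪[K] LO = 0 ↔ Valued.v ((ϖ ^ D)⁻¹ * (g₁ : Matrix (Fin 2) (Fin 2) K) 0 1) < 1) := by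
  have hshape := blockVertexShape_of_adapted h2 γ u g₁ u' hγu Y₀ hY₀ hadapt
  have hent : ∀ a b, ((Y₀ a b : 𝒪[K]) : K) = (ϖ ^ D)⁻¹ * ((((endoGL (g₁, u') : GL (Fin 3) K)) : Matrix (Fin 3) (Fin 3) K) - 1) a b := fun a b => by
    rw [hY₀, hγu]
  -- identify the residues
  have h00 : ((Y₀ 0 0 : 𝒪[K]) : K) = (ϖ ^ D)⁻¹ * (((g₁ : Matrix (Fin 2) (Fin 2) K) - 1) 0 0) := by
    rw [hent, Matrix.sub_apply, Matrix.sub_apply, coe_endoGL_eq_endoShape, Matrix.one_apply_eq, Matrix.one_apply_eq]; rfl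
  have h22 : ((Y₀ 2 2 : 𝒪[K]) : K) = (ϖ ^ D)⁻¹ * (((g₁ : Matrix (Fin 2) (Fin 2) K) - 1) 1 1) := by
    rw [hent, Matrix.sub_apply, Matrix.sub_apply, coe_endoGL_eq_endoShape, Matrix.one_apply_eq, Matrix.one_apply_eq]; rfl
  have h11 : ((Y₀ 1 1 : 𝒪[K]) : K) = (ϖ ^ D)⁻¹ * ((u' : Matrix (Fin 1) (Fin 1) K) 0 0 - 1) := by
    rw [hent, Matrix.sub_apply, coe_endoGL_eq_endoShape, Matrix.one_apply_eq]; rfl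
  have h02 : ((Y₀ 0 2 : 𝒪[K]) : K) = (ϖ ^ D)⁻¹ * (g₁ : Matrix (Fin 2) (Fin 2) K) 0 1 := by
    rw [hent, Matrix.sub_apply, coe_endoGL_eq_endoShape, Matrix.one_apply_ne (by decide), sub_zero]; rfl
  have hres02 : IsLocalRing.residue 𝒪[K] (Y₀ 0 2) = IsLocalRing.residue 𝒪[K] LO := by
    congr 1; exact Subtype.ext (by rw [h02, hLO])
  have hres0022 : IsLocalRing.residue 𝒪[K] (Y₀ 0 0) = IsLocalRing.residue 𝒪[K] (Y₀ 2 2) := by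
    rw [← sub_eq_zero, ← map_sub, residue_eq_zero_iff_v_lt_one]
    have : (((Y₀ 0 0 - Y₀ 2 2 : 𝒪[K])) : K) = (ϖ ^ D)⁻¹ * ((((g₁ : Matrix (Fin 2) (Fin 2) K) - 1) 0 0) - (((g₁ : Matrix (Fin 2) (Fin 2) K) - 1) 1 1)) := by
      push_cast; rw [h00, h22]; ring
    rw [this]; exact hsym
  have hresCO : IsLocalRing.residue 𝒪[K] (Y₀ 1 1) - (IsLocalRing.residue 𝒪[K] (Y₀ 0 0) + IsLocalRing.residue 𝒪[K] (Y₀ 2 2)) / 2 = IsLocalRing.residue 𝒪[K] CO := by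
    have h2k : (2 : 𝓀[K]) ≠ 0 := Ring.two_ne_zero (ringChar_residueField_ne_two h2)
    rw [← hres0022, ← two_mul, mul_div_cancel_left₀ _ h2k, ← map_sub]
    congr 1
    exact Subtype.ext (by push_cast; rw [h11, h00, hCO, Matrix.sub_apply, Matrix.one_apply_eq]; ring)
  refine ⟨fun x hx => by rw [hshape x hx, hresCO, hres02], ?_, ?_⟩
  · rw [residue_eq_zero_iff_v_lt_one, hCO]
  · rw [← hres02, residue_eq_zero_iff_v_lt_one, h02]

/-! ## §6 (ED. 2) The isotropic EIGENLINES of an adapted block residual matrix, and the centred-entry form of `l = 0`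

ED. 2 (append-only; A-p12 (g25) (4b) DECOMPOSITION 04:18:15Z items (K3)(i)(ii)): which children of an axis region vertex are «eigenlines» (the lines whose `q`
hanging lattices may re-enter the region, ★ `hanging_levTop_imp` ∕ (K1) `lev_far_iff_eigenline_of_odd`), and the interior test `l = 0` as «the CENTRED block is deeper
than `D` entrywise» (the lattice form `LEV^{E′}_v(ϖ^{d₀+1})` follows by ★ `map_toLin'_latt_le_scaleLattice_iff` on the consumer's side). -/

section ResidualEigen

variable {F : Type*} [Field F]

/-- **THE ISOTROPIC EIGENLINES OF AN ADAPTED, J-SYMMETRIC BLOCK MATRIX** (`char ≠ 2`): for `Ȳ ∈ M₃(k)` `ι`-shaped (`Ȳ₀₁ = Ȳ₁₀ = Ȳ₁₂ = Ȳ₂₁ = 0`), ADAPTED (`Ȳ₂₀ = 0`),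
J-SYMMETRIC (`Ȳ₀₀ = Ȳ₂₂`) and with `c = Ȳ₁₁ − Ȳ₀₀ ≠ 0` (the line-minus-block scalar), an ISOTROPIC vector `x ≠ 0` (`2x₀x₂ + x₁² = 0`) is an eigenvector of `Ȳ` iff it spans
the inward axial line `ē₀` (`x₁ = x₂ = 0`) or it spans the outward axial line `ē₂` (`x₀ = x₁ = 0`) AND `l = Ȳ₀₂ = 0`: «isotropic eigenlines `= {ē₀} ∪ {ē₂ iff l = 0}`» —
no non-axial child of an axis region vertex is an eigenline, so (★ `hanging_levTop_imp`) no collar lattice re-enters the region.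
[cite: Kottwitz1986, §3] [cite: BruhatTits1972, §10] [cite: Rogawski1990, §4.9 Prop. 4.9.1 (b) p. 55] -/
theorem isotropic_eigenvector_iff_of_block_adapted (h2 : (2 : F) ≠ 0)
    (Y : Matrix (Fin 3) (Fin 3) F) (h01 : Y 0 1 = 0) (h10 : Y 1 0 = 0) (h12 : Y 1 2 = 0) (h21 : Y 2 1 = 0) (h20 : Y 2 0 = 0)
    (hsym : Y 0 0 = Y 2 2) (hc : Y 1 1 - Y 0 0 ≠ 0)
    (x : Fin 3 → F) (hx0 : x ≠ 0) (hx : 2 * x 0 * x 2 + x 1 ^ 2 = 0) :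
    (∃ lam : F, Y *ᵥ x = lam • x) ↔ (x 1 = 0 ∧ x 2 = 0) ∨ (x 0 = 0 ∧ x 1 = 0 ∧ Y 0 2 = 0) := by
  have hYx : ∀ i, (Y *ᵥ x) i = ![Y 0 0 * x 0 + Y 0 2 * x 2, Y 1 1 * x 1, Y 2 2 * x 2] i := by
    intro i
    fin_cases i <;> simp [Matrix.mulVec, dotProduct, Fin.sum_univ_three, h01, h10, h12, h21, h20]
  constructor
  · rintro ⟨lam, hlam⟩
    have e0 := congrFun hlam 0; have e1 := congrFun hlam 1; have e2 := congrFun hlam 2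
    rw [hYx] at e0 e1 e2
    simp only [Matrix.cons_val_zero, Matrix.cons_val_one, Matrix.cons_val_two, Matrix.head_cons, Matrix.tail_cons, Pi.smul_apply, smul_eq_mul] at e0 e1 e2
    by_cases hx1 : x 1 = 0
    · have h02 : x 0 * x 2 = 0 := by
        have : 2 * (x 0 * x 2) = 0 := by rw [hx1] at hx; linear_combination hx
        rcases mul_eq_zero.1 this with h | h
        · exact absurd h h2
        · exact h
      rcases mul_eq_zero.1 h02 with hx0' | hx2
      · -- x 0 = 0, x 1 = 0: then x 2 ≠ 0 and row 0 forces Y 0 2 = 0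
        right
        refine ⟨hx0', hx1, ?_⟩
        have hx2 : x 2 ≠ 0 := by
          intro h; apply hx0; ext i; fin_cases i <;> simp [hx0', hx1, h]
        rw [hx0', mul_zero, zero_add, mul_zero] at e0
        exact (mul_eq_zero.1 e0).resolve_right hx2
      · exact Or.inl ⟨hx1, hx2⟩
    · exfalso
      have hl1 : lam = Y 1 1 := by
        have : (Y 1 1 - lam) * x 1 = 0 := by linear_combination e1
        rcases mul_eq_zero.1 this with h | h
        · linear_combination -h
        · exact absurd h hx1
      have hx2 : x 2 ≠ 0 := by
        intro h
        apply hx1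
        have : x 1 ^ 2 = 0 := by rw [h] at hx; linear_combination hx
        exact pow_eq_zero_iff two_ne_zero |>.1 this
      have hl2 : lam = Y 2 2 := by
        have : (Y 2 2 - lam) * x 2 = 0 := by linear_combination e2
        rcases mul_eq_zero.1 this with h | h
        · linear_combination -h
        · exact absurd h hx2
      exact hc (by rw [← hl1, hl2, hsym, sub_self])
  · rintro (⟨hx1, hx2⟩ | ⟨hx0', hx1, hY02⟩)
    · refine ⟨Y 0 0, ?_⟩
      ext i
      rw [hYx]
      fin_cases i <;> simp [hx1, hx2]
    · refine ⟨Y 2 2, ?_⟩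
      ext i
      rw [hYx]
      fin_cases i <;> simp [hx0', hx1, hY02]

end ResidualEigen

/-- **(K3 (i)) THE EIGENLINE DICTIONARY AT AN AXIS REGION VERTEX** (the frame of `exists_adaptedBlockFrame`, keys `CO LO` of `blockVertexShape_keys`, `res CO ≠ 0`): an
isotropic residual vector `x ≠ 0` is an eigenvector of `Ȳ₀ = res Y₀` (`Y₀ = ϖ^{−D}(↑(u⁻¹γu) − 1)`) iff `x ∥ ē₀` (the inward axial child) or (`x ∥ ē₂`, the outward axial child,
AND `res LO = 0`, i.e. the vertex is INTERIOR) — «isotropic eigenlines `= {ē₀} ∪ {ē₂ iff l = 0}`».  With ★ `hanging_levTop_imp` (F0P2-p01): no collar grandchild of an axis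
region vertex lies in the region. [cite: Kottwitz1986, §3] [cite: BruhatTits1972, §10] [cite: Rogawski1990, §4.9 Prop. 4.9.1 (b) p. 55] -/
theorem isotropic_eigenvector_residue_iff_of_adapted (h2 : Valued.v (2 : K) = 1)
    (γ u : unitaryGroupOfForm σ ((StdForm.antidiagonal 3).over K)) (g₁ : GL (Fin 2) K) (u' : GL (Fin 1) K)
    (hγu : ((u⁻¹ * γ * u : unitaryGroupOfForm σ ((StdForm.antidiagonal 3).over K)) : GL (Fin 3) K) = endoGL (g₁, u'))
    {D : ℕ} (Y₀ : Matrix (Fin 3) (Fin 3) 𝒪[K])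
    (hY₀ : ∀ a b, ((Y₀ a b : 𝒪[K]) : K) = (ϖ ^ D)⁻¹ * ((((u⁻¹ * γ * u : unitaryGroupOfForm σ ((StdForm.antidiagonal 3).over K)) : GL (Fin 3) K) : Matrix (Fin 3) (Fin 3) K) - 1) a b)
    (hadapt : Valued.v ((ϖ ^ D)⁻¹ * (g₁ : Matrix (Fin 2) (Fin 2) K) 1 0) < 1)
    (hsym : Valued.v ((ϖ ^ D)⁻¹ * ((((g₁ : Matrix (Fin 2) (Fin 2) K) - 1) 0 0) - (((g₁ : Matrix (Fin 2) (Fin 2) K) - 1) 1 1))) < 1)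
    (CO : 𝒪[K]) (hCO : (CO : K) = (ϖ ^ D)⁻¹ * ((u' : Matrix (Fin 1) (Fin 1) K) 0 0 - (g₁ : Matrix (Fin 2) (Fin 2) K) 0 0)) (hc : IsLocalRing.residue 𝒪[K] CO ≠ 0)
    (LO : 𝒪[K]) (hLO : (LO : K) = (ϖ ^ D)⁻¹ * (g₁ : Matrix (Fin 2) (Fin 2) K) 0 1)
    (x : Fin 3 → 𝓀[K]) (hx0 : x ≠ 0) (hx : 2 * x 0 * x 2 + x 1 ^ 2 = 0) :
    (∃ lam : 𝓀[K], (Y₀.map (IsLocalRing.residue 𝒪[K])) *ᵥ x = lam • x) ↔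
      (x 1 = 0 ∧ x 2 = 0) ∨ (x 0 = 0 ∧ x 1 = 0 ∧ IsLocalRing.residue 𝒪[K] LO = 0) := by
  have hent : ∀ a b, ((Y₀ a b : 𝒪[K]) : K) = (ϖ ^ D)⁻¹ * ((((endoGL (g₁, u') : GL (Fin 3) K)) : Matrix (Fin 3) (Fin 3) K) - 1) a b := fun a b => by
    rw [hY₀, hγu]
  have hzero : ∀ a b, ((((endoGL (g₁, u') : GL (Fin 3) K)) : Matrix (Fin 3) (Fin 3) K) - 1) a b = 0 → IsLocalRing.residue 𝒪[K] (Y₀ a b) = 0 := by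
    intro a b hab
    have : Y₀ a b = 0 := Subtype.ext (by rw [hent, hab, mul_zero]; rfl)
    rw [this, map_zero]
  have h01 : IsLocalRing.residue 𝒪[K] (Y₀ 0 1) = 0 := hzero 0 1 (by rw [Matrix.sub_apply, coe_endoGL_eq_endoShape]; simp)
  have h10 : IsLocalRing.residue 𝒪[K] (Y₀ 1 0) = 0 := hzero 1 0 (by rw [Matrix.sub_apply, coe_endoGL_eq_endoShape]; simp)
  have h12 : IsLocalRing.residue 𝒪[K] (Y₀ 1 2) = 0 := hzero 1 2 (by rw [Matrix.sub_apply, coe_endoGL_eq_endoShape]; simp)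
  have h21 : IsLocalRing.residue 𝒪[K] (Y₀ 2 1) = 0 := hzero 2 1 (by rw [Matrix.sub_apply, coe_endoGL_eq_endoShape]; simp)
  have h20 : IsLocalRing.residue 𝒪[K] (Y₀ 2 0) = 0 := by
    rw [residue_eq_zero_iff_v_lt_one, hent, Matrix.sub_apply, coe_endoGL_eq_endoShape, Matrix.one_apply_ne (by decide)]
    simpa using hadapt
  have h00 : ((Y₀ 0 0 : 𝒪[K]) : K) = (ϖ ^ D)⁻¹ * (((g₁ : Matrix (Fin 2) (Fin 2) K) - 1) 0 0) := by
    rw [hent, Matrix.sub_apply, Matrix.sub_apply, coe_endoGL_eq_endoShape, Matrix.one_apply_eq, Matrix.one_apply_eq]; rfl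
  have h22 : ((Y₀ 2 2 : 𝒪[K]) : K) = (ϖ ^ D)⁻¹ * (((g₁ : Matrix (Fin 2) (Fin 2) K) - 1) 1 1) := by
    rw [hent, Matrix.sub_apply, Matrix.sub_apply, coe_endoGL_eq_endoShape, Matrix.one_apply_eq, Matrix.one_apply_eq]; rfl
  have h11 : ((Y₀ 1 1 : 𝒪[K]) : K) = (ϖ ^ D)⁻¹ * ((u' : Matrix (Fin 1) (Fin 1) K) 0 0 - 1) := by
    rw [hent, Matrix.sub_apply, coe_endoGL_eq_endoShape, Matrix.one_apply_eq]; rfl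
  have h02 : ((Y₀ 0 2 : 𝒪[K]) : K) = (ϖ ^ D)⁻¹ * (g₁ : Matrix (Fin 2) (Fin 2) K) 0 1 := by
    rw [hent, Matrix.sub_apply, coe_endoGL_eq_endoShape, Matrix.one_apply_ne (by decide), sub_zero]; rfl
  have hres0022 : IsLocalRing.residue 𝒪[K] (Y₀ 0 0) = IsLocalRing.residue 𝒪[K] (Y₀ 2 2) := by
    rw [← sub_eq_zero, ← map_sub, residue_eq_zero_iff_v_lt_one]
    have : (((Y₀ 0 0 - Y₀ 2 2 : 𝒪[K])) : K) = (ϖ ^ D)⁻¹ * ((((g₁ : Matrix (Fin 2) (Fin 2) K) - 1) 0 0) - (((g₁ : Matrix (Fin 2) (Fin 2) K) - 1) 1 1)) := by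
      push_cast; rw [h00, h22]; ring
    rw [this]; exact hsym
  have hresc : IsLocalRing.residue 𝒪[K] (Y₀ 1 1) - IsLocalRing.residue 𝒪[K] (Y₀ 0 0) = IsLocalRing.residue 𝒪[K] CO := by
    rw [← map_sub]
    congr 1
    exact Subtype.ext (by push_cast; rw [h11, h00, hCO, Matrix.sub_apply, Matrix.one_apply_eq]; ring)
  have hres02 : IsLocalRing.residue 𝒪[K] (Y₀ 0 2) = IsLocalRing.residue 𝒪[K] LO := by
    congr 1; exact Subtype.ext (by rw [h02, hLO])
  have h2k : (2 : 𝓀[K]) ≠ 0 := Ring.two_ne_zero (ringChar_residueField_ne_two h2)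
  have key := isotropic_eigenvector_iff_of_block_adapted h2k (Y₀.map (IsLocalRing.residue 𝒪[K]))
    (by rw [Matrix.map_apply, h01]) (by rw [Matrix.map_apply, h10]) (by rw [Matrix.map_apply, h12]) (by rw [Matrix.map_apply, h21])
    (by rw [Matrix.map_apply, h20]) (by rw [Matrix.map_apply, Matrix.map_apply, hres0022]) (by rw [Matrix.map_apply, Matrix.map_apply, hresc]; exact hc) x hx0 hx
  rw [key, Matrix.map_apply, hres02]

/-- **(K3 (ii)) THE INTERIOR TEST IN CENTRED FORM**: in an ADAPTED, J-SYMMETRIC block frame at depth `D` (`|2| = 1`), `l = 0` — i.e. `|ϖ^{−D} g₁,₀₁| < 1` — iff the CENTRED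
block `g₁ − ½·tr(g₁)·1` is deeper than `D` ENTRYWISE: `∀ i j, |ϖ^{−D}(g₁ − ½tr g₁·1)ᵢⱼ| < 1` (its diagonal entries are `±½((g₁−1)₀₀ − (g₁−1)₁₁)`, its `(1,0)` entry is
`g₁,₁₀`).  So interior ⟺ the W-block's CENTRED level at the vertex is `≥ D + 1` (A-p12's `LEV^{E′}_v(ϖ^{d₀+1})`, matrix form). [cite: Kottwitz1986, §3] [cite: Rogawski1990, §4.9 Lemma 4.9.3 p. 56] -/
theorem v_apply_zero_one_lt_one_iff_centred_lt_one (h2 : Valued.v (2 : K) = 1) (g₁ : Matrix (Fin 2) (Fin 2) K) {D : ℕ}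
    (hadapt : Valued.v ((ϖ ^ D)⁻¹ * g₁ 1 0) < 1)
    (hsym : Valued.v ((ϖ ^ D)⁻¹ * (((g₁ - 1) 0 0) - ((g₁ - 1) 1 1))) < 1) :
    Valued.v ((ϖ ^ D)⁻¹ * g₁ 0 1) < 1 ↔ ∀ i j, Valued.v ((ϖ ^ D)⁻¹ * (g₁ - (g₁.trace / 2) • (1 : Matrix (Fin 2) (Fin 2) K)) i j) < 1 := by
  have hv2 : Valued.v ((2 : K)⁻¹) = 1 := by rw [map_inv₀, h2, inv_one]
  have h2K : (2 : K) ≠ 0 := fun h0 => by rw [h0, map_zero] at h2; exact zero_ne_one h2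
  have hdiag : Valued.v ((ϖ ^ D)⁻¹ * ((g₁ 0 0 - g₁ 1 1) / 2)) < 1 := by
    have : (ϖ ^ D)⁻¹ * ((g₁ 0 0 - g₁ 1 1) / 2) = (2 : K)⁻¹ * ((ϖ ^ D)⁻¹ * (((g₁ - 1) 0 0) - ((g₁ - 1) 1 1))) := by
      simp only [Matrix.sub_apply, Matrix.one_apply_eq]; ring
    rw [this, map_mul, hv2, one_mul]; exact hsym
  constructor
  · intro h01 i j
    rw [Matrix.trace_fin_two]
    fin_cases i <;> fin_cases j
    · simp only [Fin.zero_eta, Fin.isValue, Matrix.sub_apply, Matrix.smul_apply, Matrix.one_apply_eq, smul_eq_mul, mul_one]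
      have : (ϖ ^ D)⁻¹ * (g₁ 0 0 - (g₁ 0 0 + g₁ 1 1) / 2) = (ϖ ^ D)⁻¹ * ((g₁ 0 0 - g₁ 1 1) / 2) := by field_simp; ring
      rw [this]; exact hdiag
    · simp only [Fin.zero_eta, Fin.isValue, Fin.mk_one, Matrix.sub_apply, Matrix.smul_apply, Matrix.one_apply_ne (show (0 : Fin 2) ≠ 1 by decide), smul_zero,
        sub_zero]
      exact h01
    · simp only [Fin.zero_eta, Fin.isValue, Fin.mk_one, Matrix.sub_apply, Matrix.smul_apply, Matrix.one_apply_ne (show (1 : Fin 2) ≠ 0 by decide), smul_zero,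
        sub_zero]
      exact hadapt
    · simp only [Fin.isValue, Fin.mk_one, Matrix.sub_apply, Matrix.smul_apply, Matrix.one_apply_eq, smul_eq_mul, mul_one]
      have : (ϖ ^ D)⁻¹ * (g₁ 1 1 - (g₁ 0 0 + g₁ 1 1) / 2) = -((ϖ ^ D)⁻¹ * ((g₁ 0 0 - g₁ 1 1) / 2)) := by field_simp; ring
      rw [this, Valuation.map_neg]; exact hdiag
  · intro h
    have h01 := h 0 1
    simp only [Fin.isValue, Matrix.sub_apply, Matrix.smul_apply, Matrix.one_apply_ne (show (0 : Fin 2) ≠ 1 by decide), smul_zero, sub_zero] at h01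
    exact h01

/-! ## §7 (ED. 3) Odd depth, ANISOTROPIC diagonal form: the residual W-block is SCALAR (regime B of the anisotropic literal) -/

/-- **ODD DEPTH, ANISOTROPIC BLOCK, SMALL DISCRIMINANT ⇒ THE RESIDUAL BLOCK IS SCALAR** (the `diagonal d` twin of §2; F0P2-p01 (g17)'s (K2-odd) §a input, A-p16 (g33)
«want» 04:58:50Z).  For `g ∈ U(σ, diag(d₀,d₁))` with `diag d̄` residually ANISOTROPIC (`hanis₀`: no `c` with `d₀ + d₁·N(c) ≡ 0`), `|g − 1| ≤ |ϖ|^D` at ODD `D`, and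
`|tr(g)² − 4det(g)| < |ϖ|^{2D}` (the centred part deeper than `D`: regime B), the residual matrix `T̄ = res(ϖ^{−D}(g−1))` is SCALAR: `T̄₀₁ = T̄₁₀ = 0`, `T̄₀₀ = T̄₁₁`.
Proof: the `(0,1)` entry of `ᵗ(σg)·diag d·g = diag d` at odd depth (`σ(ϖ^D) = −ϖ^D`, `σ̄ = id`) gives the δ-SYMMETRY `d̄₀T̄₀₁ = d̄₁T̄₁₀`; `tr² − 4det = ϖ^{2D}((t₀₀−t₁₁)² + 4t₀₁t₁₀)`
gives `(T̄₀₀−T̄₁₁)² + 4T̄₀₁T̄₁₀ = 0`, i.e. `d̄₀(T̄₀₀−T̄₁₁)² + 4d̄₁T̄₁₀² = 0`; were `T̄₁₀ ≠ 0`, `c̄ = 2T̄₁₀∕(T̄₀₀−T̄₁₁)` would be a residual isotropic vector `d̄₀ + d̄₁c̄² = 0` of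
the anisotropic form — so `T̄₁₀ = 0`, whence `T̄₀₁ = 0` and `T̄₀₀ = T̄₁₁`.  Hence on the anisotropic root the line value is `ᾱ·Q̄_W(x̄_W) ≠ 0`: NO `E`-grandchild and ONE class
(`χ(−ᾱ·Q̄_W)` constant), the regime-B anisotropic census `(NE; NP, NM) = (0; (q+1)q·[¬Λ], (q+1)q·[Λ])`.
[cite: LabesseLanglands1979, §2] [cite: Kottwitz1986, §3] [cite: Rogawski1990, §4.9 Lemma 4.9.3 p. 56] -/
theorem residue_offDiag_eq_zero_and_diag_eq_of_unitary_diagonal_anisotropic_of_odd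
    (hvσ : ∀ a, Valued.v (σ a) = Valued.v a) (hσϖ : σ ϖ = -ϖ)
    (hϖ : Valued.v ϖ = WithZero.exp (-1 : ℤ)) (hres : ∀ x : K, Valued.v x ≤ 1 → Valued.v (σ x - x) < 1) (h2 : Valued.v (2 : K) = 1)
    {d : Fin 2 → K} (hd : ∀ i, Valued.v (d i) = 1)
    (hanis₀ : ∀ c : K, Valued.v c ≤ 1 → Valued.v (d 0 + d 1 * (σ c * c)) = 1)
    (g : Matrix (Fin 2) (Fin 2) K) (hg : (g.map σ)ᵀ * Matrix.diagonal d * g = Matrix.diagonal d)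
    {D : ℕ} (hD : Odd D) (T : Matrix (Fin 2) (Fin 2) 𝒪[K]) (hT : ∀ i j, ((T i j : 𝒪[K]) : K) = (ϖ ^ D)⁻¹ * (g - 1) i j)
    (hdisc : Valued.v (g.trace ^ 2 - 4 * g.det) < Valued.v ϖ ^ (2 * D)) :
    IsLocalRing.residue 𝒪[K] (T 0 1) = 0 ∧ IsLocalRing.residue 𝒪[K] (T 1 0) = 0 ∧
      IsLocalRing.residue 𝒪[K] (T 0 0) = IsLocalRing.residue 𝒪[K] (T 1 1) := by
  have hϖ0 : ϖ ≠ 0 := fun h0 => by rw [h0, map_zero] at hϖ; exact WithZero.coe_ne_zero hϖ.symm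
  have hϖ1 : Valued.v ϖ < 1 := by rw [hϖ, ← WithZero.exp_zero]; exact WithZero.exp_lt_exp.2 (by norm_num)
  have hϖD0 : (ϖ ^ D : K) ≠ 0 := pow_ne_zero _ hϖ0
  have hD1 : 1 ≤ D := hD.pos
  have hϖD1 : Valued.v (ϖ ^ D) < 1 := by rw [map_pow]; exact pow_lt_one₀ zero_le hϖ1 (by omega)
  have hTv : ∀ i j, Valued.v ((T i j : 𝒪[K]) : K) ≤ 1 := fun i j => (T i j).2
  have hTσ : ∀ i j, Valued.v (σ ((T i j : 𝒪[K]) : K)) ≤ 1 := fun i j => by rw [hvσ]; exact hTv i j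
  -- entries of `g` in terms of `T`
  have hent : ∀ i j, g i j = (1 : Matrix (Fin 2) (Fin 2) K) i j + ϖ ^ D * (T i j : K) := fun i j => by
    rw [hT, mul_inv_cancel_left₀ hϖD0, Matrix.sub_apply]; ring
  have h00 := hent 0 0; have h01 := hent 0 1; have h10 := hent 1 0; have h11 := hent 1 1
  simp only [Matrix.one_apply_eq, Matrix.one_apply_ne (show (0 : Fin 2) ≠ 1 by decide),
    Matrix.one_apply_ne (show (1 : Fin 2) ≠ 0 by decide), zero_add] at h00 h01 h10 h11
  have hσϖD : σ (ϖ ^ D) = -(ϖ ^ D) := by rw [map_pow, hσϖ, hD.neg_pow]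
  -- the `(0,1)` entry of unitarity: δ-symmetry `d₀T₀₁ − d₁σT₁₀ = ϖ^D(…)`
  have hu := congrArg (fun A => A 0 1) hg
  simp only [Matrix.mul_apply, Fin.sum_univ_two, Matrix.transpose_apply, Matrix.map_apply, Matrix.diagonal_apply_eq,
    Matrix.diagonal_apply_ne _ (show (0 : Fin 2) ≠ 1 by decide), Matrix.diagonal_apply_ne _ (show (1 : Fin 2) ≠ 0 by decide),
    mul_zero, add_zero, zero_add] at hu
  simp only [h00, h01, h10, h11, map_add, map_one, map_mul, hσϖD] at hu
  have k01 : d 0 * (T 0 1 : K) - d 1 * σ (T 1 0 : K) = ϖ ^ D * (d 0 * σ (T 0 0 : K) * (T 0 1 : K) + d 1 * σ (T 1 0 : K) * (T 1 1 : K)) := by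
    apply mul_left_cancel₀ hϖD0
    linear_combination hu
  -- residues
  have hdmem : ∀ i, d i ∈ 𝒪[K] := fun i => (Valuation.mem_integer_iff _ _).2 (hd i).le
  have hσmem : ∀ i j, σ ((T i j : 𝒪[K]) : K) ∈ 𝒪[K] := fun i j => (Valuation.mem_integer_iff _ _).2 (hTσ i j)
  set dO : Fin 2 → 𝒪[K] := fun i => ⟨d i, hdmem i⟩ with hdO
  set sT10 : 𝒪[K] := ⟨σ ((T 1 0 : 𝒪[K]) : K), hσmem 1 0⟩ with hsT10
  have hres_d : ∀ i, IsLocalRing.residue 𝒪[K] (dO i) ≠ 0 := fun i h0 => by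
    rw [residue_eq_zero_iff_v_lt_one] at h0
    exact absurd (hd i) (ne_of_lt h0)
  have hres_sT10 : IsLocalRing.residue 𝒪[K] sT10 = IsLocalRing.residue 𝒪[K] (T 1 0) := residue_map_sigma_eq hvσ hres (T 1 0)
  -- δ-symmetry in the residue field
  have hsym : IsLocalRing.residue 𝒪[K] (dO 0) * IsLocalRing.residue 𝒪[K] (T 0 1) =
      IsLocalRing.residue 𝒪[K] (dO 1) * IsLocalRing.residue 𝒪[K] (T 1 0) := by
    rw [← hres_sT10, ← map_mul, ← map_mul, ← sub_eq_zero, ← map_sub, residue_eq_zero_iff_v_lt_one]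
    have : (((dO 0 * T 0 1 - dO 1 * sT10 : 𝒪[K])) : K) = d 0 * (T 0 1 : K) - d 1 * σ (T 1 0 : K) := by push_cast; simp [hdO, hsT10]
    rw [this, k01, map_mul]
    refine mul_lt_one_of_lt_of_le hϖD1 ((Valued.v.map_add _ _).trans (max_le ?_ ?_))
    · rw [map_mul, map_mul, hd 0, one_mul]; exact mul_le_one' (hTσ 0 0) (hTv 0 1)
    · rw [map_mul, map_mul, hd 1, one_mul]; exact mul_le_one' (hTσ 1 0) (hTv 1 1)
  -- the discriminant: `(T̄₀₀ − T̄₁₁)² + 4 T̄₀₁ T̄₁₀ = 0`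
  have hdisc_eq : g.trace ^ 2 - 4 * g.det = (ϖ ^ D) ^ 2 * ((((T 0 0 : K) - (T 1 1 : K)) ^ 2 + 4 * ((T 0 1 : K) * (T 1 0 : K)))) := by
    rw [Matrix.trace_fin_two, Matrix.det_fin_two, h00, h01, h10, h11]; ring
  have hX : IsLocalRing.residue 𝒪[K] (((T 0 0 - T 1 1) ^ 2 + 4 * (T 0 1 * T 1 0) : 𝒪[K])) = 0 := by
    rw [residue_eq_zero_iff_v_lt_one]
    push_cast
    rw [hdisc_eq, map_mul, map_pow, map_pow, ← pow_mul, mul_comm D 2] at hdisc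
    have hpos : 0 < Valued.v ϖ ^ (2 * D) := pow_pos (zero_lt_iff.2 ((Valuation.ne_zero_iff _).2 hϖ0)) _
    calc Valued.v ((((T 0 0 : K) - (T 1 1 : K)) ^ 2 + 4 * ((T 0 1 : K) * (T 1 0 : K))))
        = (Valued.v ϖ ^ (2 * D))⁻¹ * (Valued.v ϖ ^ (2 * D) * Valued.v ((((T 0 0 : K) - (T 1 1 : K)) ^ 2 + 4 * ((T 0 1 : K) * (T 1 0 : K))))) := by
          rw [inv_mul_cancel_left₀ hpos.ne']
      _ < (Valued.v ϖ ^ (2 * D))⁻¹ * Valued.v ϖ ^ (2 * D) := mul_lt_mul_of_pos_left hdisc (inv_pos.2 hpos)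
      _ = 1 := inv_mul_cancel₀ hpos.ne'
  simp only [map_add, map_pow, map_sub, map_mul, map_ofNat] at hX
  -- abbreviations in the residue field
  set a : 𝓀[K] := IsLocalRing.residue 𝒪[K] (T 0 0) - IsLocalRing.residue 𝒪[K] (T 1 1) with ha
  set b : 𝓀[K] := IsLocalRing.residue 𝒪[K] (T 1 0) with hb
  set e0 : 𝓀[K] := IsLocalRing.residue 𝒪[K] (dO 0) with he0
  set e1 : 𝓀[K] := IsLocalRing.residue 𝒪[K] (dO 1) with he1
  have h2k : (2 : 𝓀[K]) ≠ 0 := Ring.two_ne_zero (ringChar_residueField_ne_two h2)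
  -- `T̄₀₁ = (e1/e0)·b` and `e0·a² + 4 e1 b² = 0`
  have h01' : IsLocalRing.residue 𝒪[K] (T 0 1) = e1 * b / e0 := by
    rw [eq_div_iff (hres_d 0), mul_comm, ← he0]; exact hsym
  have hquad : e0 * a ^ 2 + 4 * e1 * b ^ 2 = 0 := by
    linear_combination e0 * hX - 4 * b * hsym
  -- `b = 0`: otherwise `c̄ = 2b∕a` is a residual isotropic vector
  have hb0 : b = 0 := by
    by_contra hbne
    have hane : a ≠ 0 := by
      intro ha0
      rw [ha0] at hquad
      have : 4 * e1 * b ^ 2 = 0 := by simpa using hquad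
      rcases mul_eq_zero.1 this with h | h
      · rcases mul_eq_zero.1 h with h4 | h4
        · exact absurd h4 (by rw [show (4 : 𝓀[K]) = 2 * 2 by norm_num]; exact mul_ne_zero h2k h2k)
        · exact hres_d 1 h4
      · exact hbne (pow_eq_zero_iff two_ne_zero |>.1 h)
    obtain ⟨c, hc⟩ := IsLocalRing.residue_surjective (R := 𝒪[K]) (2 * b / a)
    have hcv : Valued.v (c : K) ≤ 1 := c.2
    have hN := hanis₀ c hcv
    -- the residue of `d₀ + d₁ σ(c) c` vanishes
    have hσc : σ (c : K) ∈ 𝒪[K] := (Valuation.mem_integer_iff _ _).2 (by rw [hvσ]; exact hcv)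
    have hres_c : IsLocalRing.residue 𝒪[K] ⟨σ (c : K), hσc⟩ = IsLocalRing.residue 𝒪[K] c := residue_map_sigma_eq hvσ hres c
    have hzero : IsLocalRing.residue 𝒪[K] ((dO 0 + dO 1 * (⟨σ (c : K), hσc⟩ * c) : 𝒪[K])) = 0 := by
      rw [map_add, map_mul, map_mul, hres_c, hc, ← he0, ← he1]
      have : e0 + e1 * (2 * b / a * (2 * b / a)) = (e0 * a ^ 2 + 4 * e1 * b ^ 2) / a ^ 2 := by field_simp; ring
      rw [this, hquad, zero_div]
    rw [residue_eq_zero_iff_v_lt_one] at hzero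
    have hcoe : (((dO 0 + dO 1 * (⟨σ (c : K), hσc⟩ * c) : 𝒪[K])) : K) = d 0 + d 1 * (σ (c : K) * (c : K)) := by push_cast; simp [hdO]
    rw [hcoe, hN] at hzero
    exact lt_irrefl _ hzero
  refine ⟨?_, hb0, ?_⟩
  · rw [h01', hb0, mul_zero, zero_div]
  · have h0 : e0 * a ^ 2 = 0 := by
      have := hquad; rw [hb0] at this; simpa using this
    exact sub_eq_zero.1 (pow_eq_zero_iff two_ne_zero |>.1 ((mul_eq_zero.1 h0).resolve_left (hres_d 0)))

end Literature.NumberTheory.Automorphic.UnitaryLatticeTree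

end
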